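import Summits.QuantumFields.BalabanUV.T4Continuum.Support.NE7DecompOfDbar
import Summits.QuantumFields.BalabanUV.T4Continuum.Support.NE7HdecompOfTopNormalised
import HarnessLib

/-!
# Support | NE7 (gen 98, THE PER-PAIR BINDER OVER ROAD-Γ′ WITH S2′, AT `d = 4`, `L = 2`): `hdecomp_body_of_dbar` — the BODY of the per-pair binder `hdecomp♭` of
# `NE7HintOfSliceNormalisationSU2Dec.hint_SU2_of_decomposition` from (A′) a representative with TRIVIAL TOP DOUBLE-BAR FIELD (`U′^{u} = U_s·e^{X}` for ANY unitary `u` — corner values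
# free —, `U̿′^{k+1} = 1`, `sup‖X‖·M ≤ α̂`) and (B′) the three masses of the slice-correcting generator PLUS the two frame masses `Θ₂, Θ₁` of `log v_{k+1}` — every regime binder discharged
# from `ε ≤ ε₀` and the four α̂-lines, as in `NE7HdecompOfTopNormalised`

Cell `pub-balaban`, rung (B)+1 sub-cell t4, lineage `b2b-balaban-t4-ne7-p1` (CRUX PROVER NE7 #1 = OWNER of row NE7), generation 98; memo `t4/b2b-balaban-t4-ne7-p1-g98/ROAD-G98.md` §2.8.
Over this generation's `NE7DecompOfDbar.decomp_of_dbar` (S5′) and the numeric lemmas of `NE7HdecompOfTopNormalised` §1 (ceilings, `levelSmall_d4_L2`, `radSum_d4_L2_le`, `exp_line`,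
`pdev_le_of_smallField'`, `radius_identities`) BY NAME.

WHY (memo §2.8).  The repaired top normalisation S2′ (corner rotation by the inverse frame) delivers `hdbar` with a NON-corner-trivial gauge and k-free frame masses; THIS FILE is the per-pair
binder in that currency — the S2′ twin of p745178 — so that the END′ `hint_SU2_of_dbar` asks exactly what S1 + S2′ and the mass letters supply.
WHAT ([folklore]; 0 def, 0 sorry).  **`hdecomp_body_of_dbar`**.
HONEST FRAMING (page 1): composition and real arithmetic over landed kernel theorems; (A′), (B′) are HYPOTHESES asserted for nothing; nothing of Bałaban's asserted; NE7 NOT PROVED; spine 0∕9; finite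
T⁴ rung (B)+1 — NOT infinite volume, NOT mass gap, NOT `BetaPertH`, NOT Clay.  Continuum YM on T⁴ ⇐ BetaPertH ∧ nine spine estimates (0/9 proved); BetaPertH ⇐ (D1) ∧ (D4) ∧ CAP+tail; G-an2-4
gates asym, D1 and NE2/3/4.
-/

set_option autoImplicit false

open scoped BigOperators Matrix Matrix.Norms.L2Operator Topology
open NormedSpace Finset Set Filter

namespace Summit.QuantumFields.BalabanUV.T4Continuum.NE7HdecompOfDbar

open Literature.MathematicalPhysics.QuantumFieldTheory.Balaban1983to89
open B7Prop1Explicit B7Prop2Explicit B7Prop3Flat MatrixLog UnitaryModel MatrixNorms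
open T4AveragingDeficitWall (Ad IsUnitaryCfg IsSkewDir SmallField vary curl curlSq dirSq dirL1)
open T4AveragingDeficitWallBoundary (IsPeriodicCfg periodBox)
open AveragingDeficitPeriodicCounting (IsPeriodicDir)
open AveragingDeficitMultiLevelPrep (LevelSmall tower TangentIter cavgIter radIter)
open AveragingDeficitTwoLevelPrep (twoLevelSmall)
open AveragingDeficitMultiLevelBridge (cavgIter_eq_avgIter)
open ReplicationRightInverseBound (radSum)
open BlockAverageVaryHolo (nbRad)
open NE3CovariantLineSumsError (Csup Csup_nonneg)
open ShellMeasureAverageProp4General (C1cov C1cov_pos)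
open MinimalActionLevels (perWin)
open MinimalActionRate (sfClass)
open NE3TangentCovariantTower (dirIter QbarIter framePotW)
open B7Eq92Concrete (vcov)
open NE3.PairLandauB8Avg (relPert)
open BlockAveragePushDirGauge (gaugeDir)
open NE3CornerSpikes (spikeW)
open NE3QbarIterCovLiftPrep (cruxC)
open NE3SmoothRightInverseW (rightInvW)
open NE3RightInverseSolveLetters (thetaLoc thetaLoc_nonneg cruxC_le_thetaLoc)
open NE3RightInverseL2Letter (l2C l2C_nonneg)
open NE3HatInvCurlLetters (curl2C curl1C curl2C_nonneg curl1C_nonneg)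
open NE3RightInverseLetters (theta_lt_one_of_loc)
open NE3EnergyShapes (IsUnitarySite IsPeriodicSite)
open NE3EnergyWeightedShapes (energyNormW energyNormW_nonneg)
open NE3FrameFreeSliceW (frameFreeBlockLandauW)
open NE3ClassRadiusFamily (levelSmall_family_d4_L2 radIter_radSum_le_of_small)
open B7Eq92Concrete (dbavgCovIter)
open NE7DecompOfDbar (decomp_of_dbar)
open NE7HdecompOfTopNormalised (pdev_le_of_smallField' ceiling_one ceiling_two ceiling_three ceiling_four radius_identities levelSmall_d4_L2 radSum_d4_L2_le exp_line)

noncomputable section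

variable {n : Type} [Fintype n] [DecidableEq n]

/-! ## §1 The `hdecomp♭` body under `hdbar`, at `d = 4`, `L = 2` -/

/-- **THE PER-PAIR BINDER `hdecomp♭` FROM (A) A TOP-NORMALISED REPRESENTATIVE AND (B) THE THREE MASSES** (`d = 4`, `L = 2`, level `k+1`, `M = 2^{k+1}`, `x = ε∕M²`).  ε-LINES: `ε ≤ 10⁻¹¹`,
`thetaLoc·ε < 1`, `C0·4ε ≤ 1∕3`, `16ε ≤ c2'`, the ℓ¹ tower line at radius `(8∕3)(ε∕4)`; α̂-LINES: `8·131072·25·α̂ ≤ 1∕10`, `4α̂ ≤ c3`, the `hK` line, `352α̂ ≤ 1`.  CLASS DATA: `U_s` unitary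
`(N·M)`-periodic with `SmallField U_s x`, common `(k+1)`-fold average `D` of `U_s` and `U′`.  (A): a unitary CORNER-TRIVIAL gauge `u`, a skew `(N·M)`-periodic `X` with `sup‖X‖ ≤ b`, `M·b ≤ α̂`,
`U′^{u} = U_s·e^{X}` and TRIVIAL ACCUMULATED TOP FRAME `v_{k+1} ≡ 1`.  (B): the three masses `(m₂, p₂, m₁)` of every corner-trivial slice-correcting generator of the tangent residual (the
hypothesis `hμ` of `NE7DecompOfTopNormalised.decomp_of_topNormalised`, its proof arguments universally bound).  LINES ON THE CEILINGS: `ν(α̂, ε, m₂, p₂) ≤ ν̂`, `κ(ε, m₁) ≤ κ̂` (displayed).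
CONCLUSION: the body of `hdecomp♭` of `NE7HintOfSliceNormalisationSU2Dec.hint_SU2_of_decomposition` for this pair, with `α = b`. [folklore] -/
theorem hdecomp_body_of_dbar [Nonempty n] {N : ℕ} [NeZero N] (hN : 1 ≤ N) (k : ℕ) {ε : ℝ} (hε : 0 < ε)
    (hε11 : ε ≤ 1 / 10 ^ 11) (hεθ : thetaLoc 4 2 * ε < 1) (hεC0 : C0 4 * (2 * (2 * ε)) ≤ 1 / 3) (hεc2 : 4 * (2 * (2 * ε)) ≤ c2' 4 2)
    (hεS1 : 16 * (((4 : ℕ) : ℝ) + 1) * (((4 : ℕ) : ℝ) + 4) * ((2 : ℕ) : ℝ) ^ 2 * Csup 4 2 * (((4 : ℕ) : ℝ) * (2 * ((nbRad 4 2 : ℕ) : ℝ) + 1) ^ 4) * (8 / 3 * (ε / 4))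
      ≤ ((2 : ℕ) : ℝ) / ((2 : ℕ) : ℝ) ^ 4 / 2)
    {Us U' : Site 4 → Fin 4 → (Matrix n n ℂ)ˣ} (hWu : IsUnitaryCfg Us) (hWP : IsPeriodicCfg Us ((N * 2 ^ (k + 1) : ℕ) : ℤ))
    (hWx : SmallField Us (ε / (((2 : ℕ) : ℝ) ^ (k + 1)) ^ 2))
    {αh : ℝ} (hαh1 : 8 * (131072 * (((4 : ℕ) : ℝ) + 1) ^ 2) * αh ≤ 1 / 10) (hαh2 : 4 * αh ≤ c3 4 2)
    (hαh3 : 16 * (C1cov 4 * ((2 : ℕ) : ℝ) ^ 2 * Real.sqrt (((4 : ℕ) : ℝ) * (2 * (2 * ((2 : ℕ) : ℝ)) + 1) ^ 4)) * αh ≤ Real.sqrt (((2 : ℕ) : ℝ) ^ 2 / ((2 : ℕ) : ℝ) ^ 4))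
    (hαh4 : 44 * (((4 : ℕ) : ℝ) * ((2 : ℕ) : ℝ) * αh) ≤ 1)
    {u : Site 4 → (Matrix n n ℂ)ˣ} {X : Site 4 → Fin 4 → Matrix n n ℂ} {b : ℝ}
    (hu : IsUnitarySite u) (hXs : IsSkewDir X) (hXP : IsPeriodicDir X ((N * 2 ^ (k + 1) : ℕ) : ℤ))
    (hb : 0 ≤ b) (hX : ∀ (y : Site 4) (κ : Fin 4), ‖X y κ‖ ≤ b) (hrep : gaugeAct u U' = vary Us X 1)
    (hdbar : dbavgCovIter 2 Us (relPert Us X) (k + 1) = 1) (hbα : ((2 : ℕ) : ℝ) ^ (k + 1) * b ≤ αh)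
    {Θ₂ Θ₁ : ℝ} (hΘ₂0 : 0 ≤ Θ₂) (hΘ₂ : ∑ z ∈ periodBox (d := 4) N, ‖mlog ((vcov 2 Us (relPert Us X) (k + 1) z : (Matrix n n ℂ)ˣ) : Matrix n n ℂ)‖ ^ 2
      ≤ Θ₂ * (((2 : ℕ) : ℝ) ^ (k + 1)) ^ 2 * energyNormW 2 (k + 1) Us X (periodBox (d := 4) (N * 2 ^ (k + 1))) ^ 2)
    (hΘ₁0 : 0 ≤ Θ₁) (hΘ₁ : ∑ z ∈ periodBox (d := 4) N, ‖mlog ((vcov 2 Us (relPert Us X) (k + 1) z : (Matrix n n ℂ)ˣ) : Matrix n n ℂ)‖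
      ≤ Θ₁ * (((2 : ℕ) : ℝ) ^ (k + 1)) ^ 2 * energyNormW 2 (k + 1) Us X (periodBox (d := 4) (N * 2 ^ (k + 1))) ^ 2)
    {m₂ p₂ m₁ : ℝ} (hm₂ : 0 ≤ m₂) (hp₂ : 0 ≤ p₂) (hm₁ : 0 ≤ m₁)
    (hμ : ∀ (hx0 : 0 ≤ ε / (((2 : ℕ) : ℝ) ^ (k + 1)) ^ 2) (hsm0 : LevelSmall 4 2 k (ε / (((2 : ℕ) : ℝ) ^ (k + 1)) ^ 2))
        (hθ0 : cruxC 4 2 * ((((2 : ℕ) : ℝ) ^ (k + 1)) ^ 2 * (ε / (((2 : ℕ) : ℝ) ^ (k + 1)) ^ 2)) < 1)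
        (hYs : IsSkewDir (dirIter 2 (k + 1) Us (fun y ν => X y ν - gaugeDir Us (spikeW (2 ^ (k + 1)) (framePotW 2 (k + 1) Us X)) y ν)))
        (mu : Site 4 → Matrix n n ℂ), (∀ y, mu y ∈ skewAdjoint (Matrix n n ℂ)) →
        (∀ (y : Site 4) (i : Fin 4), mu (y + ((N * 2 ^ (k + 1) : ℕ) : ℤ) • e i) = mu y) → (∀ w : Site 4, mu ((((2 : ℕ) : ℤ) ^ (k + 1)) • w) = 0) →
        (fun y ν => (X y ν - (gaugeDir Us (spikeW (2 ^ (k + 1)) (framePotW 2 (k + 1) Us X)) + rightInvW (le_refl 2) k hWu hx0 hsm0 hWx N hθ0 hYs) y ν) + gaugeDir Us mu y ν)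
          ∈ frameFreeBlockLandauW (d := 4) (n := n) 2 N (k + 1) Us →
        dirSq (gaugeDir Us mu) (periodBox (d := 4) (N * 2 ^ (k + 1))) ≤ m₂ * (((2 : ℕ) : ℝ) ^ (k + 1)) ^ 2 * energyNormW 2 (k + 1) Us X (periodBox (d := 4) (N * 2 ^ (k + 1))) ^ 2
        ∧ ∑ z ∈ periodBox (d := 4) (N * 2 ^ (k + 1)), ‖mu z‖ ^ 2 ≤ p₂ * (((2 : ℕ) : ℝ) ^ (k + 1)) ^ 4 * energyNormW 2 (k + 1) Us X (periodBox (d := 4) (N * 2 ^ (k + 1))) ^ 2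
        ∧ ∑ z ∈ periodBox (d := 4) (N * 2 ^ (k + 1)), ‖mu z‖ ≤ m₁ * (((2 : ℕ) : ℝ) ^ (k + 1)) ^ 3 * energyNormW 2 (k + 1) Us X (periodBox (d := 4) (N * 2 ^ (k + 1))) ^ 2)
    {νh κh : ℝ}
    (hνh : 2 * Real.sqrt (((Fintype.card (T4AveragingDeficitWall.Plane 4) : ℝ) + ((4 : ℕ) : ℝ))
            * (3 * Θ₂ + (12288 * ((((4 : ℕ) : ℝ)) ^ 3 * ((2 : ℕ) : ℝ) ^ 5) * 2 + 3072 * ((((4 : ℕ) : ℝ)) * ((2 : ℕ) : ℝ)) * (C1cov 4 * ((2 : ℕ) : ℝ) ^ 2 * Real.sqrt (((4 : ℕ) : ℝ) * (2 * (2 * ((2 : ℕ) : ℝ)) + 1) ^ 4)) ^ 2 * 1)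
              * αh ^ 2))
          + Real.sqrt ((l2C 4 2 / (1 - thetaLoc 4 2 * ε) ^ 2 + curl2C 4 2 / (1 - thetaLoc 4 2 * ε) ^ 2)
              * (1024 * (C1cov 4 * ((2 : ℕ) : ℝ) ^ 2 * Real.sqrt (((4 : ℕ) : ℝ) * (2 * (2 * ((2 : ℕ) : ℝ)) + 1) ^ 4)) ^ 2 * (((2 : ℕ) : ℝ) ^ 4 / ((2 : ℕ) : ℝ) ^ 4))) * αh
          + Real.sqrt (4 * ε ^ 2 * (Fintype.card (T4AveragingDeficitWall.Plane 4)) * p₂ + m₂) ≤ νh)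
    (hκh : 2 * (Fintype.card (T4AveragingDeficitWall.Plane 4) : ℝ)
            * (Θ₁ + (16 * ((((4 : ℕ) : ℝ)) * ((2 : ℕ) : ℝ)) * (6 * 2 + 2 * (4 / 3)) + 64 * (C1cov 4 * ((2 : ℕ) : ℝ) ^ 2 * (((4 : ℕ) : ℝ) * (2 * (2 * ((2 : ℕ) : ℝ)) + 1) ^ 4)) * (4 / 3))) * ε ^ 2
          + (curl1C 4 2 / (1 - thetaLoc 4 2 * ε)) * ε * (64 * (C1cov 4 * ((2 : ℕ) : ℝ) ^ 2 * (((4 : ℕ) : ℝ) * (2 * (2 * ((2 : ℕ) : ℝ)) + 1) ^ 4)) * (((2 : ℕ) : ℝ) ^ 4 / ((2 : ℕ) : ℝ) ^ 2))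
          + 2 * (Fintype.card (T4AveragingDeficitWall.Plane 4)) * ε ^ 2 * m₁ ≤ κh) :
    ∃ (u : Site 4 → (Matrix n n ℂ)ˣ) (X XT XN : Site 4 → Fin 4 → Matrix n n ℂ) (α ν κ : ℝ),
      IsUnitarySite u ∧ IsSkewDir X ∧ IsPeriodicDir X ((N * 2 ^ (k + 1) : ℕ) : ℤ) ∧ 0 ≤ α ∧ (∀ x μ, ‖X x μ‖ ≤ α) ∧
      gaugeAct u U' = vary Us X 1 ∧
      X = XT + XN ∧ XT ∈ frameFreeBlockLandauW (d := 4) (n := n) 2 N (k + 1) Us ∧ IsSkewDir XN ∧ 0 ≤ ν ∧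
      energyNormW 2 (k + 1) Us XN (periodBox (d := 4) (N * 2 ^ (k + 1)))
        ≤ ν * energyNormW 2 (k + 1) Us X (periodBox (d := 4) (N * 2 ^ (k + 1))) ∧
      ε / (((2 : ℕ) : ℝ) ^ (k + 1)) ^ 2 * (∑ p ∈ perWin 4 (N * 2 ^ (k + 1)), ‖curl Us XN p‖)
        ≤ κ * energyNormW 2 (k + 1) Us X (periodBox (d := 4) (N * 2 ^ (k + 1))) ^ 2 ∧
      α * ((2 : ℕ) : ℝ) ^ (k + 1) ≤ αh ∧ ν ≤ νh ∧ κ ≤ κh := by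
  -- the radius identities (no `set`: the binder types of `hμ` depend on these terms)
  have hid := radius_identities k ε
  have hM0 : (0 : ℝ) < ((2 : ℕ) : ℝ) ^ (k + 1) := by positivity
  have hx0 : 0 ≤ ε / (((2 : ℕ) : ℝ) ^ (k + 1)) ^ 2 := by positivity
  have hsm0 : LevelSmall 4 2 k (ε / (((2 : ℕ) : ℝ) ^ (k + 1)) ^ 2) := levelSmall_d4_L2 hε.le hε11 k
  have hθl0 : thetaLoc 4 2 * ((((2 : ℕ) : ℝ) ^ (k + 1)) ^ 2 * (ε / (((2 : ℕ) : ℝ) ^ (k + 1)) ^ 2)) < 1 := by rw [hid.2]; exact hεθ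
  have hθ0 : cruxC 4 2 * ((((2 : ℕ) : ℝ) ^ (k + 1)) ^ 2 * (ε / (((2 : ℕ) : ℝ) ^ (k + 1)) ^ 2)) < 1 := theta_lt_one_of_loc (d := 4) k hx0 hθl0
  have hε1 : (((2 : ℕ) : ℝ) ^ (k + 1)) ^ 2 * (ε / (((2 : ℕ) : ℝ) ^ (k + 1)) ^ 2) ≤ 1 := by
    rw [hid.2]; norm_num at hε11; linarith
  have hMb : 0 ≤ ((2 : ℕ) : ℝ) ^ (k + 1) * b := by positivity
  have hαh0 : 0 ≤ αh := hMb.trans hbα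
  -- the decomposition with all regime binders discharged
  obtain ⟨XT, XN, ν, κ, hXeq, hTmem, hNs, hν0, hN1, hN2, hνeq, hκeq⟩ :=
    decomp_of_dbar (d := 4) (L := 2) (N := N) (le_refl 2) (by norm_num) hN k (W := Us)
      (x := ε / (((2 : ℕ) : ℝ) ^ (k + 1)) ^ 2)
      hWu hWP hx0 hsm0 hWx hθ0 hθl0 hε1 (α₀ := 2 * ε) (b := b) (by positivity) hεC0 hεc2
      (by
        have h1 := pdev_le_of_smallField' hx0 hWx
        have h2 : ε / (((2 : ℕ) : ℝ) ^ (k + 1)) ^ 2 < 2 * ε * ((((2 : ℕ) : ℝ) ^ (k + 1))⁻¹) ^ 2 := by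
          rw [inv_pow, ← div_eq_mul_inv]
          exact div_lt_div_of_pos_right (by linarith) (by positivity)
        exact lt_of_le_of_lt h1 h2)
      hb hX hXP hXs
      (by
        refine exp_line (by positivity) ?_ (by positivity) ?_
        · norm_num at hε11 ⊢; nlinarith
        · have h : 8 * (131072 * (((4 : ℕ) : ℝ) + 1) ^ 2) * (((2 : ℕ) : ℝ) ^ (k + 1) * b) ≤ 8 * (131072 * (((4 : ℕ) : ℝ) + 1) ^ 2) * αh :=
            mul_le_mul_of_nonneg_left hbα (by positivity)
          exact h.trans hαh1)
      (by linarith [hbα, hαh2])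
      (by
        have hK0 : 0 ≤ 16 * (C1cov 4 * ((2 : ℕ) : ℝ) ^ 2 * Real.sqrt (((4 : ℕ) : ℝ) * (2 * (2 * ((2 : ℕ) : ℝ)) + 1) ^ 4)) := by
          have := C1cov_pos 4; positivity
        have h : 16 * (C1cov 4 * ((2 : ℕ) : ℝ) ^ 2 * Real.sqrt (((4 : ℕ) : ℝ) * (2 * (2 * ((2 : ℕ) : ℝ)) + 1) ^ 4)) * ((2 : ℕ) : ℝ) ^ (k + 1) * b
            = 16 * (C1cov 4 * ((2 : ℕ) : ℝ) ^ 2 * Real.sqrt (((4 : ℕ) : ℝ) * (2 * (2 * ((2 : ℕ) : ℝ)) + 1) ^ 4)) * (((2 : ℕ) : ℝ) ^ (k + 1) * b) := by ring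
        rw [h]
        exact (mul_le_mul_of_nonneg_left hbα hK0).trans hαh3)
      (by
        have hr := radSum_d4_L2_le hε.le hε11 k
        have hC : 0 ≤ 16 * (((4 : ℕ) : ℝ) + 1) * (((4 : ℕ) : ℝ) + 4) * ((2 : ℕ) : ℝ) ^ 2 * Csup 4 2 * (((4 : ℕ) : ℝ) * (2 * ((nbRad 4 2 : ℕ) : ℝ) + 1) ^ 4) := by
          have := Csup_nonneg 4 2; positivity
        exact (mul_le_mul_of_nonneg_left hr hC).trans hεS1)
      (by
        calc 44 * ((((4 : ℕ) : ℝ)) * ((2 : ℕ) : ℝ) * (((2 : ℕ) : ℝ) ^ (k + 1) * b))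
            = 44 * (((4 : ℕ) : ℝ) * ((2 : ℕ) : ℝ)) * (((2 : ℕ) : ℝ) ^ (k + 1) * b) := by ring
          _ ≤ 44 * (((4 : ℕ) : ℝ) * ((2 : ℕ) : ℝ)) * αh := mul_le_mul_of_nonneg_left hbα (by positivity)
          _ = 44 * (((4 : ℕ) : ℝ) * ((2 : ℕ) : ℝ) * αh) := by ring
          _ ≤ 1 := hαh4)
      hdbar hΘ₂0 hΘ₂ hΘ₁0 hΘ₁
      (Γ₁ := 2) (Γ₂ := 1) (Γ₃ := 4 / 3) (Γ₄ := 4 / 3) (ceiling_one k) (ceiling_two k) (ceiling_three k) (ceiling_four k)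
      hm₂ hp₂ hm₁ (fun hYs mu h1 h2 h3 h4 => hμ hx0 hsm0 hθ0 hYs mu h1 h2 h3 h4)
  -- the currencies
  rw [hid.2] at hνeq hκeq
  have hsq : (((2 : ℕ) : ℝ) ^ (k + 1) * b) ^ 2 ≤ αh ^ 2 := pow_le_pow_left₀ hMb hbα 2
  have key : ∀ {P' T A' B C : ℝ}, 0 ≤ P' → 0 ≤ A' → 0 ≤ B →
      2 * Real.sqrt (P' * (T + A' * αh ^ 2)) + B * αh + C ≤ νh →
      2 * Real.sqrt (P' * (T + A' * (((2 : ℕ) : ℝ) ^ (k + 1) * b) ^ 2)) + B * (((2 : ℕ) : ℝ) ^ (k + 1) * b) + C ≤ νh := by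
    intro P' T A' B C hP' hA' hB h
    have h0 : A' * (((2 : ℕ) : ℝ) ^ (k + 1) * b) ^ 2 ≤ A' * αh ^ 2 := mul_le_mul_of_nonneg_left hsq hA'
    have h1 : P' * (T + A' * (((2 : ℕ) : ℝ) ^ (k + 1) * b) ^ 2) ≤ P' * (T + A' * αh ^ 2) :=
      mul_le_mul_of_nonneg_left (by linarith) hP'
    have h2 := Real.sqrt_le_sqrt h1
    have h3 := mul_le_mul_of_nonneg_left hbα hB
    linarith
  refine ⟨u, X, XT, XN, b, ν, κ, hu, hXs, hXP, hb, hX, hrep, hXeq, hTmem, hNs, hν0, hN1, hN2, ?_, ?_, ?_⟩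
  · rw [mul_comm]; exact hbα
  · rw [hνeq]
    exact key (by positivity) (by have := C1cov_pos 4; positivity) (by positivity) hνh
  · rw [hκeq]; exact hκh

end

end Summit.QuantumFields.BalabanUV.T4Continuum.NE7HdecompOfDbar
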